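import Literature.MathematicalPhysics.QuantumFieldTheory.Balaban1983to89.B9Thm313WholeDvHolderAtPinsPrint

/-!
# `Balaban1983to89.B9Thm33G0DirXHolderAtPinsPrint` — THE W-c FACE `Φ^X_β∘∇_{U,ν}∘G₀∘D_U` (dag-n06-w6's `Thm33G0DirX.pXdDH`, the certificate's `hXd`) AT THE
# PRINT-WEIGHTED PIN (P2′) `bH13 := bHZPG (taxiS U) w`: from PRINT-LITERAL (3.45) members `bHZKP (taxiB U) (sch β) → 𝔠_{P_X}^{(β−1)}` read along an exponent schedule and the
# print-weighted transported `J`-letter — the (A′) twin of `B9Thm33G0DirXHolderAtPinsGraded` §1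

T. Bałaban, *Propagators for lattice gauge theories in a background field*, Commun. Math. Phys. **99** (1985) 389–434
[`Balaban1985BackgroundPropagators`, "B9"]; [4] = T. Bałaban, *Propagators and renormalization transformations for lattice gauge
theories. II*, Commun. Math. Phys. **96** (1984) 223–250 [`Balaban1984PropagatorsII`].

statement-level skeleton of published theorems with citation tags; proofs where landed; nothing here is a claim about the
Yang–Mills mass gap

THE PRINTED LOCI.  [B9] Thm 3.3 p. 399 (G₀ = G(U) *"satisfies the inequalities (3.42)–(3.47)"*), (3.45) p. 398 (*"‖ζ∇_UG′(U)∇\*_Uλ‖_β ≦ B′₀(ε,β)(Lʲη)^{−β}(…)e^{−δ₀d}(‖λ‖^{ξ′}_{β+ε} + |λ|)"*),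
(3.3) p. 390, pp. 421–423 (the W-c face); [4] (2.52)–(2.56) pp. 232–233, Lemma 2.1 (2.60)–(2.61) p. 234.

WHY THIS FILE (cell `pub-ymgap`, node N06, seat dag-n06-l g24; repair (A′) of LOCATED-U6, `BH13-UNITS-MEMO.md`).  At the current pin the face `hXd` is DERIVED (n06-d ED.51) by
`B9Thm33G0DirXHolderAtPinsGraded.pXdDH_graded_of_h45` from displayed (3.45) members `h45X` at `bHZKT (taxiB U) (sch β) p` INTO THE SHARP PROBE BLOCKS (`B_Z(β)·(Lʲη)^{−β}·e`,
a dimension-0 claim) and the `(Lʲη)`-carrying J-letter of the `(Lʲη)⁻¹`-weighted pin.  At the print-weighted pin the intermediate certifies dimension 1 itself, so the (3.45)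
members are displayed LITERALLY — `Φ^X_β∘∇_{U,ν}∘G₀∘∇\*_{U,μ} : bHZKP (taxiB U) (sch β) → 𝔠_{P_X}^{(β−1)}` with `B_Z(β)·e^{−δ₀d}` (a unit of the source has `‖λ‖^{ξ′}_{sch β} + |λ| ≤ 2Lʲ′η`,
(3.45) gives `‖out‖_β ≲ (Lʲη)^{1−β}`) — and the J-letter is `B9Thm313WholeDvHolderAtPinsPrint.hJ_print` (constant `CJG(sch β)·L`, rate `δ_J − αδ_F`).
* ★★ `pXdDH_print_of_h45` — for every `ν` and `β ∈ [0,1)`: `HasMaj (bHZPG (taxiS U) w) (cNormR blkPX (β−1)) ((Φ β ∘ Dd ν ∘ G0) ∘ Dv) (BdX β·e^{−δ₃d})`,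
  `BdX β ≥ (d+1)·((1 + C_Lip)·B_Z(β)·(CJG d ℓ b (sch β) ϑ_L (w (sch β)) δ_J·L)·c)`, rates `0 ≤ δ₃ ≤ δ₀`, `δ₃ + σ ≤ δ_J − αδ_F` — engine `…FromDdsFree.pYDH_of_h45Y_one` (X-probes),
  NO `Facts347` length transfer inside.
HONEST SCOPE.  Kernel bookkeeping; the (3.45) members and the plaquette binder are HYPOTHESES of printed species; nothing of [B9]∕[4] asserted; no certificate edit;
COUNT-NEUTRAL; N06 NOT discharged; nothing continuum, nothing about the mass gap.  Cell `pub-ymgap` (HUMAN RULING D-0062), Track A node N06 [B9], seat `pub-ymgap-dag-n06-l`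
(g24), 2026-08-29.
-/

noncomputable section

namespace Literature.MathematicalPhysics.QuantumFieldTheory.Balaban1983to89.B9Thm33G0DirXHolderAtPinsPrint

open scoped Matrix.Norms.L2Operator
open Node00 B6GlobalChartV1 B6KLevelCensusIndexV1
open B6Geom246MultiLevelTorus (geomT)
open B6Ineq2142KLevelV1 (β)
open B11SectG (HasMaj RowSum BlockNorm)
open B9Thm34Ext (toB6)
open B9Thm312Whole (GeoOK)
open B9Thm312WholeClasses (cNormR)
open B9RWSums343to347Whole (Facts347)
open B9CoReadingCoords (XBK coordOpK cdsBₗ)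
open B9CoReadingCoordsS (XSK)
open B7Prop2SpecialUnitary (specialUnitaryUnits specialUnitaryUnits_le_U1)
open Node00.OpsYSectDCoords (DvcoKH)
open B9GeoNormsKLevelV1 (geo9K)
open B9GradViaDivLettersAtPins (JcoKH DvcoKH_eq_sum)
open B9Thm313WholeDvHolderFromDdsFree (pYDH_of_h45Y_one)
open B9Thm313WholeDvHolderAtPinsGraded (thetaL thetaL_nonneg CJG CJG_nonneg)
open B9Thm313WholeDvHolderAtPinsPrint (hJ_print)
open B9MultiscaleSmoothPartitionYLip (CLip CLip_nonneg)
open B9SmoothHolderClassP (bHZKP bHZKP_κ bHZPG)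
open B9GradViaDivLettersTransported (taxiS taxiB)
open B9TaxiTransportLadder (plaqV)
open Node00.OpsYNablaBridge (chartY)

variable {d ℓ : ℕ} {hd : 1 ≤ d + 1} {hL : Odd (ℓ + 1) ∧ 1 < ℓ + 1} {b₀ b₁ : ℝ}
variable (i : KIdx d ℓ hd hL b₀ b₁) [Fintype (geo9K i).Site] {κ : Type} [Fintype κ]
variable {N : ℕ} [NeZero N] (B : B9.Backgrounds) (rd : B.Cfg → CfgY (Matrix (Fin N) (Fin N) ℂ) i) (b : Module.Basis κ ℝ (Matrix (Fin N) (Fin N) ℂ))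

/-- ★★ **THE W-c FACE AT THE PRINT-WEIGHTED PIN FROM PRINT-LITERAL (3.45) MEMBERS READ ALONG AN EXPONENT SCHEDULE**: for every `ν` and `β ∈ [0,1)`,
`HasMaj (bHZPG i b (taxiS U) w) (𝔠_{P_X}^{(β−1)}) ((Φ β ∘ Dd ν ∘ G0) ∘ Dv) (BdX β·e^{−δ₃d})` from `h45 ν μ β : HasMaj (bHZKP i b (taxiB U) (sch β)) (𝔠_{P_X}^{(β−1)}) (Φ β∘Dd ν∘G0∘Dds μ)
(B_Z(β)·e^{−δ₀d})` ((3.45) literally, `s = sch β > β`, `0 < w (sch β)`), the kinematic decomposition `Dv = Σ_μ Dds μ∘J_μ(U)` (`hDv hDds`) and the print-weighted J-letter (binders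
`hU hF hFa hcf`); `BdX β ≥ (d+1)·((1 + C_Lip d ℓ)·B_Z(β)·(CJG d ℓ b (sch β) ϑ_L (w (sch β)) δ_J·L)·c)`, `0 ≤ δ₃ ≤ δ₀`, `δ₃ + σ ≤ δ_J − αδ_F`.
[cite: Balaban1985BackgroundPropagators, Thm 3.3 (3.45) p.398 + (3.40) p.397 + (3.35) p.396 + (3.3) p.390 + pp.421–423; Balaban1984PropagatorsII, (2.52)–(2.56) pp.232–233 + Lemma 2.1 (2.60)–(2.61) p.234] -/
theorem pXdDH_print_of_h45 {bI : FBondY i → IBondY i}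
    (hβ1 : ∀ f : FBondY i, (geomT i.D).dist (β i.hN i.D i.hk (bI f)) (blkV1 i.hN i.D f) ≤ 1)
    (hbI0 : ∀ f : FBondY i, bI f = bI ⟨f.src, 0⟩) {U : B.Cfg}
    (hUG : ∀ (ν : Fin (d + 1)) (x : Site (PV d ℓ i.m i.K hd hL) 0), rd U ν x ∈ specialUnitaryUnits (Fin N)) {ϑF : ℝ} (hϑF : 0 ≤ ϑF)
    (hF : ∀ (y : Site (PV d ℓ i.m i.K hd hL) 0) (μ' ν' : Fin (d + 1)),
      ‖(plaqV (rd U) y μ' ν' : Matrix (Fin N) (Fin N) ℂ) - 1‖ ≤ ϑF * ((((ℓ + 1 : ℕ) : ℝ)) ^ levY i (chartY i y))⁻¹)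
    (w : ℝ → ℝ) (hw0 : ∀ s, 0 ≤ w s) (hw1 : ∀ s, w s ≤ 1)
    (sch : ℝ → ℝ) (hsch0 : ∀ β', 0 ≤ β' → β' < 1 → 0 < sch β') (hsch1 : ∀ β', 0 ≤ β' → β' < 1 → sch β' < 1)
    (hwsch : ∀ β', 0 ≤ β' → β' < 1 → 0 < w (sch β'))
    {R₀ : ℝ} {H₀ : Prop} (hG : GeoOK (geo9K i)) {σ c : ℝ} (hrow : RowSum (toB6 (geo9K i) R₀ H₀) σ c)
    {dF : ℕ} {δF α L₀ : ℝ} (hFa : Facts347 (geo9K i) R₀ H₀ dF δF α L₀) (hcf : |i.cf| = (B6Prop22KLevelTorusCensusEta.nKT (toKT i) : ℝ))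
    {PX : Type} [Fintype PX] {blkPX : PX → (geo9K i).Site}
    {Φ : ℝ → ((XBK κ i → ℝ) →ₗ[ℝ] (PX → ℝ))} {G0 : Module.End ℝ (XBK κ i → ℝ)} {Dd Dds : Fin (d + 1) → Module.End ℝ (XBK κ i → ℝ)}
    {Dv : (XSK κ i → ℝ) →ₗ[ℝ] (XBK κ i → ℝ)}
    (hDv : Dv = DvcoKH i b B rd U) (hDds : Dds = fun μ => coordOpK b (fun _ : Fin (d + 1) => cdsBₗ i (rd U) μ))
    {BZ : ℝ → ℝ} {δ₀ δJ δ₃ : ℝ} {BdX : ℝ → ℝ}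
    (hBZ : ∀ β', 0 ≤ β' → β' < 1 → 0 ≤ BZ β') (hc : 0 ≤ c) (hδJ : 0 ≤ δJ)
    (hδ₃ : 0 ≤ δ₃) (hδ₃0 : δ₃ ≤ δ₀) (hδ₃J : δ₃ + σ ≤ δJ - α * δF)
    (hBdX : ∀ β', 0 ≤ β' → β' < 1 →
      ((d : ℝ) + 1) * ((1 + CLip d ℓ) * BZ β' * (CJG d ℓ b (sch β') (thetaL d ℓ ϑF) (w (sch β')) δJ * (geo9K i).L) * c) ≤ BdX β')
    (h45 : ∀ (ν μ : Fin (d + 1)) (β' : ℝ) (h0 : 0 ≤ β') (h1 : β' < 1),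
      HasMaj (bHZKP (κ := κ) i b (taxiB i B rd U) (R := R₀) (H := H₀) (s := sch β') (hsch0 β' h0 h1).le (hsch1 β' h0 h1).le)
        (cNormR R₀ H₀ blkPX hG.lenle (β' - 1))
        (Φ β' ∘ₗ (Dd ν ∘ₗ (G0 ∘ₗ Dds μ))) (fun a a' => BZ β' * Real.exp (-(δ₀ * (geo9K i).dist a a')))) :
    ∀ (ν : Fin (d + 1)) (β' : ℝ), 0 ≤ β' → β' < 1 →
      HasMaj (bHZPG (κ := κ) i b (taxiS i B rd U) (R := R₀) (H := H₀) w hw0 hw1)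
        (cNormR R₀ H₀ blkPX hG.lenle (β' - 1)) ((Φ β' ∘ₗ Dd ν ∘ₗ G0) ∘ₗ Dv)
        (fun a a' => BdX β' * Real.exp (-(δ₃ * (geo9K i).dist a a'))) := by
  intro ν β' hβ0 hβ1'
  have hU : ∀ (ν : Fin (d + 1)) (x : Site (PV d ℓ i.m i.K hd hL) 0), ‖(rd U ν x : Matrix (Fin N) (Fin N) ℂ)‖ ≤ 1 ∧
      ‖(((rd U ν x)⁻¹ : (Matrix (Fin N) (Fin N) ℂ)ˣ) : Matrix (Fin N) (Fin N) ℂ)‖ ≤ 1 := fun ν x => specialUnitaryUnits_le_U1 (hUG ν x)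
  have hDv' : Dv = ∑ μ, Dds μ ∘ₗ JcoKH i b B rd μ U := by rw [hDv, hDds]; exact DvcoKH_eq_sum i b B rd U
  have hJ := fun μ => hJ_print i B rd b w hw0 hw1 (hsch0 β' hβ0 hβ1') (hsch1 β' hβ0 hβ1') (hwsch β' hβ0 hβ1') hFa hcf hβ1 hbI0 hU hϑF hF hδJ μ
  have hCJ : 0 ≤ CJG d ℓ b (sch β') (thetaL d ℓ ϑF) (w (sch β')) δJ * (geo9K i).L :=
    mul_nonneg (CJG_nonneg (d := d) (ℓ := ℓ) b (thetaL_nonneg d ℓ hϑF) (hwsch β' hβ0 hβ1') δJ) (le_trans zero_le_one hFa.one_le_L)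
  have hκ : (bHZKP (κ := κ) i b (taxiB i B rd U) (R := R₀) (H := H₀) (s := sch β') (hsch0 β' hβ0 hβ1').le (hsch1 β' hβ0 hβ1').le).κ ≤ 1 + CLip d ℓ :=
    le_of_eq (bHZKP_κ i b _ _ _)
  have hBdX' : (Fintype.card (Fin (d + 1)) : ℝ) *
      ((1 + CLip d ℓ) * BZ β' * (CJG d ℓ b (sch β') (thetaL d ℓ ϑF) (w (sch β')) δJ * (geo9K i).L) * c) ≤ BdX β' := by
    rw [Fintype.card_fin, Nat.cast_add, Nat.cast_one]; exact hBdX β' hβ0 hβ1'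
  exact pYDH_of_h45Y_one hG hrow (hBZ β' hβ0 hβ1') hCJ hc hκ hδ₃ hδ₃0 hδ₃J hBdX' hDv' (fun μ => h45 ν μ β' hβ0 hβ1') hJ

end Literature.MathematicalPhysics.QuantumFieldTheory.Balaban1983to89.B9Thm33G0DirXHolderAtPinsPrint

end
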